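import Summits.RiemannHypothesis.RiemannHypothesis.Theorems.SemilocalNegCertThirtySevenKinked1862
import HarnessLib

/-!
# Semi-local threshold of the `{∞,2,…,37}` form, negative side: `a*({2,…,37}) ≤ 1907 / 1024 = 1.8623046875` — the wall `q = 41` from a KINKED (piecewise-cubic) witness with slope breaks at the prime-atom images (part 12/15: the kernel facts piece 154 … piece 167 of 182 (imports part 1 only))

Cell `rh-explicit` (HOME `run/shared/lean/pub/rh-explicit/`), seat cc-s2-9 gen2 (HUMAN RULING D-0074 (D5) WEIL data engine; LADDER-RH column WEIL, rung DATA → W-P(P2);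
pipeline = cc-s2-4 gen8/gen11's piecewise-witness layer `SemilocalPiecewise{Witness,Increment,IncrementSum,Cert}.lean` + their float finder, every number
re-derived by an independent second engine E2 before filing; gen0's rows: `SemilocalNegCert{ThirteenKinked1423,SeventeenKinked1478,NineteenKinked1573,TwentyThreeKinked1690,TwentyNineKinked1723}*`).
HONEST FRAMING: RH-FREE theorems about the tree's `weilSemilocalThreshold S` of a TRUNCATED Weil form (finitely many places); nothing here bears on the
truth of RH; the lower clause `(log q)/2 ≤ a*(S_q)` at all primes IS RH and is untouched; the SIGN of `δ*(41)` is not claimed.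

KINKED row for the wall `q = 41` (`S = {2,…,37}`): at `b = 1907 / 1024 = 1.8623046875 ≈ a*(S_41) + 0.0055` (DATA, two engines, cc-s2-6/cc-s2-3: `a*(S_41) = 1.85685`)
the polynomial × indicator class is far from negative (tree row `15/8`, `SemilocalNegCertUptoThirtySeven`, `δ*(41) ≤ 0.0182`), whereas an odd piecewise cubic with slope breaks at the images
`|b − log n|` (rounded to `/1024`) of the atoms `n ∈ {2,3,5,7,11,13,17,19,23,29,31,37}` (the twelve PRIME atoms; images of 4, 8, 9, 16, 25, 27, 32 dropped — all nineteen kinks: λ_min = −1.16·10⁻², primes + 4 + 9: −5.26·10⁻³; kit j253132) is negative by `2.856e-03·‖G‖²`.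
Instance: `S = {2, 3, 5, 7, 11, 13, 17, 19, 23, 29, 31, 37}`, `N = 42` (atom table `atomsUptoThirtySeven` / `atomsEnclose_UptoThirtySeven` of `SemilocalNegCertUptoThirtySeven.lean`), 13 pieces of degree ≤ 3, 182 `t`-pieces;
TWO ENGINES on the witness before the kernel: cc-s2-4's float finder `λ_min = -2.8564e-03` and the seat's exact-in-`x` decimal engine E2 `R = -2.8595e-03` (no polar credit);
the exact kernel margin is the certificate's own rational arithmetic (farm report).  ⇒ **`a*({2,…,37}) ≤ 1907 / 1024`, `δ*(41) < 0.005519`** (was `0.0182`).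
No data is trusted: every bound is a `decide +kernel` fact.  Folklore throughout.
-/

set_option autoImplicit false
set_option linter.dupNamespace false  -- the mandated namespace repeats `RiemannHypothesis`
set_option Elab.async false  -- serialise the kernel facts: in parallel they exhaust the node's per-process heap (cc-s2-4 gen11, CC4-LEAN §16.10)

noncomputable section

open Complex Filter Set MeasureTheory Topology
open scoped Real

namespace Summit.RiemannHypothesis.RiemannHypothesis.Theorems.SemilocalPolyWitness

open MeasureTheory Set Finset Real
open Literature.NumberTheory.LFunctions
open Summit.RiemannHypothesis.RiemannHypothesis.Theorems.MotivicDoor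
open Summit.RiemannHypothesis.RiemannHypothesis.Theorems.MotivicDoor.SemilocalThreshold
open Summit.RiemannHypothesis.RiemannHypothesis.Theorems.MotivicDoor.SemilocalMarkov
open LQ

set_option maxHeartbeats 0 in
/-- kernel fact: piece `154` of `certThirtySevenKinked1862`. -/
theorem check_ThirtySevenKinked1862_piece154 : certThirtySevenKinked1862.checkPiecePW 154 = true := by
  decide +kernel

set_option maxHeartbeats 0 in
/-- kernel fact: piece `155` of `certThirtySevenKinked1862`. -/
theorem check_ThirtySevenKinked1862_piece155 : certThirtySevenKinked1862.checkPiecePW 155 = true := by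
  decide +kernel

set_option maxHeartbeats 0 in
/-- kernel fact: piece `156` of `certThirtySevenKinked1862`. -/
theorem check_ThirtySevenKinked1862_piece156 : certThirtySevenKinked1862.checkPiecePW 156 = true := by
  decide +kernel

set_option maxHeartbeats 0 in
/-- kernel fact: piece `157` of `certThirtySevenKinked1862`. -/
theorem check_ThirtySevenKinked1862_piece157 : certThirtySevenKinked1862.checkPiecePW 157 = true := by
  decide +kernel

set_option maxHeartbeats 0 in
/-- kernel fact: piece `158` of `certThirtySevenKinked1862`. -/
theorem check_ThirtySevenKinked1862_piece158 : certThirtySevenKinked1862.checkPiecePW 158 = true := by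
  decide +kernel

set_option maxHeartbeats 0 in
/-- kernel fact: piece `159` of `certThirtySevenKinked1862`. -/
theorem check_ThirtySevenKinked1862_piece159 : certThirtySevenKinked1862.checkPiecePW 159 = true := by
  decide +kernel

set_option maxHeartbeats 0 in
/-- kernel fact: piece `160` of `certThirtySevenKinked1862`. -/
theorem check_ThirtySevenKinked1862_piece160 : certThirtySevenKinked1862.checkPiecePW 160 = true := by
  decide +kernel

set_option maxHeartbeats 0 in
/-- kernel fact: piece `161` of `certThirtySevenKinked1862`. -/
theorem check_ThirtySevenKinked1862_piece161 : certThirtySevenKinked1862.checkPiecePW 161 = true := by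
  decide +kernel

set_option maxHeartbeats 0 in
/-- kernel fact: piece `162` of `certThirtySevenKinked1862`. -/
theorem check_ThirtySevenKinked1862_piece162 : certThirtySevenKinked1862.checkPiecePW 162 = true := by
  decide +kernel

set_option maxHeartbeats 0 in
/-- kernel fact: piece `163` of `certThirtySevenKinked1862`. -/
theorem check_ThirtySevenKinked1862_piece163 : certThirtySevenKinked1862.checkPiecePW 163 = true := by
  decide +kernel

set_option maxHeartbeats 0 in
/-- kernel fact: piece `164` of `certThirtySevenKinked1862`. -/
theorem check_ThirtySevenKinked1862_piece164 : certThirtySevenKinked1862.checkPiecePW 164 = true := by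
  decide +kernel

set_option maxHeartbeats 0 in
/-- kernel fact: piece `165` of `certThirtySevenKinked1862`. -/
theorem check_ThirtySevenKinked1862_piece165 : certThirtySevenKinked1862.checkPiecePW 165 = true := by
  decide +kernel

set_option maxHeartbeats 0 in
/-- kernel fact: piece `166` of `certThirtySevenKinked1862`. -/
theorem check_ThirtySevenKinked1862_piece166 : certThirtySevenKinked1862.checkPiecePW 166 = true := by
  decide +kernel

set_option maxHeartbeats 0 in
/-- kernel fact: piece `167` of `certThirtySevenKinked1862`. -/
theorem check_ThirtySevenKinked1862_piece167 : certThirtySevenKinked1862.checkPiecePW 167 = true := by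
  decide +kernel

end Summit.RiemannHypothesis.RiemannHypothesis.Theorems.SemilocalPolyWitness

end
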